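import Summits.HodgeConjecture.HodgeConjecture.Theorems.EndoscopicMiddleDegreeCupProductAlgebraic
import Literature.AlgebraicGeometry.HodgeTheory.MotivatedClassesAssembly
import HarnessLib

/-!
# Ring 2 — literature lane: the named fact "`B` for all ⟹ `A_mot(X) ⊆ A(X)`" (André 1996 §2.1) DISCHARGED

HONEST FRAMING (page 1, verbatim the cell's standing line): **research route conditional on HC_CM; not a
corollary; Q11.4-sentence-2 already refuted in dim ≥ 3.** Nothing in this file proves a case of the Hodge
conjecture, and `HC_CM` plays no role here.

The Literature named fact
`Literature.AlgebraicGeometry.HodgeTheory.Andre1996_motivatedClasses_le_algebraicClasses_of_standardConjectureB`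
(file `Literature/AlgebraicGeometry/HodgeTheory/MotivatedClasses.lean`; André 1996, §2.1, remark following
Déf. 1: under Grothendieck's standard conjecture `B` for all smooth projective complex varieties, motivated
classes are algebraic) is REDUCED in the Literature layer, by the PROVED assembly
`Andre1996_motivatedClasses_le_algebraicClasses_of_standardConjectureB_holds_of`
(`HodgeTheory/MotivatedClassesAssembly`), to the multiplicativity fact
`Voisin2003_cupProduct_algebraicClasses` (cup products of algebraic classes are algebraic, Voisin II
Prop. 9.20), and that fact is a THEOREM of the tree on the summit side:
`Summit.HodgeConjecture.HodgeConjecture.Theorems.Voisin2003_cupProduct_algebraicClasses_holds`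
(`Theorems/EndoscopicMiddleDegreeCupProductAlgebraic`, from the proved pull-back theorem
`fulton1998_map_mem_algebraicClasses_holds` along the diagonal). Composing the two gives the named fact
WITHOUT HYPOTHESES. The composition has to live summit-side (a Literature module may not import a
`Summits` module), which is why this one-theorem file exists; consumers that bind
`(hBA : Andre1996_motivatedClasses_le_algebraicClasses_of_standardConjectureB)` — e.g.
`Ring2HypothesesDescent.motivatedImpliesAlgebraic_of_standardConjectureB`,
`HeckePrymWeilHodgeWeilOfStandardConjectureB`, `WeilTypeLadderMotivated`,
`AnchorTransportVariationalHodgeReductions`, `WeilVariationalHodge/Negative/DominatedByHodge` — can feed it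
`Andre1996_motivatedClasses_le_algebraicClasses_of_standardConjectureB_holds`.

References (bib keys): Andre1996Motifs (§2.1 remark following Déf. 1, p. 14; §0.3), VoisinHodgeII2003
(Prop. 9.20, Prop. 9.21 (i)), Fulton1998 (§19.2 Cor. 19.2 (b)), Grothendieck1968 (§3, B(X)).
-/

set_option linter.dupNamespace false

noncomputable section

namespace Summit.HodgeConjecture.HodgeConjecture.Theorems

open Literature.AlgebraicGeometry.HodgeTheory

/-- **André 1996, §2.1 (remark following Déf. 1): `B` for every smooth projective complex variety ⟹
motivated classes are algebraic — the tree's named fact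
`Andre1996_motivatedClasses_le_algebraicClasses_of_standardConjectureB`, now WITHOUT HYPOTHESES.**
Proof: the Literature assembly `…_holds_of` (the fact follows from the multiplicativity of algebraic
classes) applied to the summit-side theorem `Voisin2003_cupProduct_algebraicClasses_holds`.
[cite: Andre1996Motifs, §2.1 remark following Déf. 1 (p. 14)] [cite: VoisinHodgeII2003, Prop. 9.20 and Prop. 9.21 (i)] -/
theorem Andre1996_motivatedClasses_le_algebraicClasses_of_standardConjectureB_holds :
    Andre1996_motivatedClasses_le_algebraicClasses_of_standardConjectureB :=
  Andre1996_motivatedClasses_le_algebraicClasses_of_standardConjectureB_holds_of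
    Voisin2003_cupProduct_algebraicClasses_holds

end Summit.HodgeConjecture.HodgeConjecture.Theorems

end
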